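import Literature.Probability.NegativeDependence.StronglyRayleighNegativeAssociation
import Literature.Combinatorics.StablePolynomials.GraceWalshSzego
import Literature.Combinatorics.StablePolynomials.UnivariateStabilityPreservers
import Literature.Combinatorics.StablePolynomials.RealRootedRestriction
import HarnessLib

/-!
# Exchangeable strongly Rayleigh measures (Borcea–Brändén–Liggett, Def. 2.1 and Thm. 3.8 (a) ⟺ (b))

J. Borcea, P. Brändén, T. M. Liggett, *Negative dependence and the geometry of polynomials*, J. Amer. Math.
Soc. 22 (2009) 521–567 (arXiv:0707.2340, held `paper:arxiv-0707.2340`; numbering of the arXiv version).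
Verbatim:

> (§2.1) **Definition 2.1.** A complex measure `μ` on `2^[n]` is called *symmetric* or *exchangeable* if
> `σ(μ) = μ` for any `σ ∈ 𝔖_n`, or equivalently, its generating polynomial `g_μ` is symmetric in all `n`
> variables. […] **Definition 2.8.** The diagonal specialization of a polynomial `f ∈ ℂ[z_1,…,z_n]` is the
> univariate polynomial `t ↦ Δ(f)(t) = f(t,…,t)`. […] If `μ ∈ 𝔓_n` the sequence
> `{μ(Σ_i X_i = k)}_{k=0}^n = {Δ(g_μ)^{(k)}(0)/k!}_{k=0}^n` is called the *rank sequence* of `μ`.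
> (§3.1) A univariate polynomial with real coefficients is stable if and only if it has all real zeros.
>
> (§3.5) **Theorem 3.8 (Exchangeable Strongly Rayleigh Case).** Suppose `μ ∈ 𝔓_n` has a symmetric generating
> polynomial and rank sequence `{r_k}_{k=0}^n`. The following are equivalent: (a) The generating polynomial
> of `μ` is stable, i.e., `μ` is strongly Rayleigh; (b) All zeros of the univariate polynomial
> `Σ_{k=0}^n r_k z^k` are real; (c) The infinite Toeplitz matrix `(r_{i-j})_{i,j=0}^∞` is TP […].
> *Proof.* The equivalence (b) ⟺ (c) is a classical result due to Aissen, Schoenberg and Whitney [ASW], while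
> the equivalence (a) ⟺ (b) is a consequence of the Grace–Walsh–Szegö coincidence theorem. □

## Transposition and scope

* Weights `μ : Finset σ → ℝ` on the subsets of a finite type (`StableOrZero`, `multiAffine` as in the sibling
  files). `IsExchangeable μ` is Def. 2.1 (invariance under `Equiv.Perm σ`); §1 shows it means
  `μ(S) = b(|S|)` (`isExchangeable_iff_exists_card`), the form in which the tree's symmetry lemma
  `rename_equiv_multiAffine_card` is stated.
* `rankSeq μ k = μ({|S| = k})`, `rankPoly μ = Δ(g_μ) = Σ_k r_k t^k` (the tree's `diagonal` of `multiAffine μ`;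
  `coeff_rankPoly`, `rankPoly_eq_sum`).
* (a) ⟺ (b) exactly as printed: `g_μ` (symmetric, multi-affine) is the polarization of `Δ(g_μ)` (tree
  `polarization_diagonal`), so it is stable iff `Δ(g_μ)` has no zero in `ℋ` (tree
  `isUpperHalfPlaneStable_polarization_iff`, Grace–Walsh–Szegő), iff `Σ r_k t^k` is real-rooted
  (`forall_roots_im_eq_zero_iff`, conjugation). Stated for all real exchangeable weights with "(a)" as
  `StableOrZero` (the zero weight satisfies both sides); for `μ ≠ 0` also as `IsRealStable (multiAffine μ)`.
* -- TODO(general form): (c), the Aissen–Schoenberg–Whitney total-positivity characterization, is not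
  formalized.

## Contents

* §1 `IsExchangeable`, `isExchangeable_card`, `IsExchangeable.eq_of_card_eq`, `IsExchangeable.exists_eq_card`,
  `isExchangeable_iff_exists_card`.
* §2 `rankSeq`, `rankSeq_card`, `rankPoly`, `coeff_rankPoly`, `natDegree_rankPoly_le`, `rankPoly_eq_sum`,
  `map_rankPoly`, `rankPoly_card_ne_zero`.
* §3 `forall_roots_im_eq_zero_iff` (real univariate: real-rooted ⟺ zero-free on `ℋ`).
* §4 **`stableOrZero_card_iff`**, **`IsExchangeable.stableOrZero_iff`**, `IsExchangeable.isRealStable_iff_roots_real`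
  (Thm. 3.8 (a) ⟺ (b)).

## References

* [BorceaBrandenLiggett2007] J. Borcea, P. Brändén, T. M. Liggett, Negative dependence and the geometry of
  polynomials, J. Amer. Math. Soc. 22 (2009), 521–567; arXiv:0707.2340.
* [BorceaBranden2009II] J. Borcea, P. Brändén, The Lee–Yang and Pólya–Schur programs II (Grace–Walsh–Szegő,
  polarization; tree `GraceWalshSzego.lean`).
-/

noncomputable section

open Finset MvPolynomial
open scoped ComplexConjugate
open Literature.Combinatorics.Sahi2008
open Literature.Combinatorics.StablePolynomials

namespace Literature.Probability.NegativeDependence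

variable {σ : Type*} [Fintype σ] [DecidableEq σ]

/-! ## §1 Symmetric (exchangeable) weights (BBL Def. 2.1) -/

section Exchangeable

/-- **Symmetric or exchangeable weight** (BBL Def. 2.1): `σ(μ) = μ` for every permutation `σ ∈ 𝔖_n`, i.e.
`μ(σ(S)) = μ(S)`. [cite: BorceaBrandenLiggett2007, §2.1 Def. 2.1] -/
def IsExchangeable (μ : Finset σ → ℝ) : Prop := ∀ (e : Equiv.Perm σ) (S : Finset σ), μ (S.map e.toEmbedding) = μ S

omit [Fintype σ] [DecidableEq σ] in
/-- A weight depending only on `|S|` is exchangeable. [cite: BorceaBrandenLiggett2007, §2.1 Def. 2.1] -/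
theorem isExchangeable_card (b : ℕ → ℝ) : IsExchangeable (fun S : Finset σ => b S.card) :=
  fun e S => by simp only [Finset.card_map]

/-- Two subsets of the same size are exchanged by a permutation of the ground set. [folklore] -/
private theorem exists_perm_map_eq {S T : Finset σ} (hST : S.card = T.card) :
    ∃ e : Equiv.Perm σ, S.map e.toEmbedding = T := by
  classical
  have h1 : Fintype.card {x // x ∈ S} = Fintype.card {x // x ∈ T} := by simp [hST]
  have h2 : Fintype.card {x // ¬ x ∈ S} = Fintype.card {x // ¬ x ∈ T} := by
    rw [Fintype.card_subtype_compl, Fintype.card_subtype_compl, Fintype.card_coe, Fintype.card_coe, hST]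
  refine ⟨Equiv.subtypeCongr (Fintype.equivOfCardEq h1) (Fintype.equivOfCardEq h2), ?_⟩
  apply Finset.eq_of_subset_of_card_le
  · intro y hy
    obtain ⟨x, hx, rfl⟩ := Finset.mem_map.1 hy
    change (Equiv.subtypeCongr _ _) x ∈ T
    rw [Equiv.subtypeCongr, Equiv.trans_apply, Equiv.trans_apply, Equiv.sumCompl_symm_apply_of_pos hx,
      Equiv.sumCongr_apply, Sum.map_inl, Equiv.sumCompl_apply_inl]
    exact Subtype.prop _
  · rw [Finset.card_map, hST]

/-- An exchangeable weight takes the same value on sets of the same size. [cite: BorceaBrandenLiggett2007,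
§2.1 Def. 2.1 ("`g_μ` is symmetric in all `n` variables")] -/
theorem IsExchangeable.eq_of_card_eq {μ : Finset σ → ℝ} (h : IsExchangeable μ) {S T : Finset σ}
    (hST : S.card = T.card) : μ S = μ T := by
  obtain ⟨e, he⟩ := exists_perm_map_eq hST
  rw [← he, h e S]

/-- **Exchangeable weights are the weights `S ↦ b(|S|)`.** [cite: BorceaBrandenLiggett2007, §2.1 Def. 2.1] -/
theorem IsExchangeable.exists_eq_card {μ : Finset σ → ℝ} (h : IsExchangeable μ) :
    ∃ b : ℕ → ℝ, μ = fun S => b S.card := by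
  classical
  refine ⟨fun k => if hk : ∃ S : Finset σ, S.card = k then μ hk.choose else 0, funext fun S => ?_⟩
  have hk : ∃ T : Finset σ, T.card = S.card := ⟨S, rfl⟩
  dsimp only
  rw [dif_pos hk]
  exact h.eq_of_card_eq hk.choose_spec.symm

omit [Fintype σ] [DecidableEq σ] in
/-- Conversely. [cite: BorceaBrandenLiggett2007, §2.1 Def. 2.1] -/
theorem isExchangeable_iff_exists_card [Fintype σ] (μ : Finset σ → ℝ) :
    IsExchangeable μ ↔ ∃ b : ℕ → ℝ, μ = fun S => b S.card := by
  classical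
  refine ⟨fun h => h.exists_eq_card, ?_⟩
  rintro ⟨b, rfl⟩
  exact isExchangeable_card b

end Exchangeable

/-! ## §2 The rank sequence and the rank polynomial `Σ_k r_k t^k` -/

section Rank

/-- **The rank sequence** `r_k = μ(Σ_i X_i = k) = μ({S : |S| = k})` of a weight on `2^[n]`.
[cite: BorceaBrandenLiggett2007, §2.1 Def. 2.8 ("is called the rank sequence of `μ`") and §3.5 Thm. 3.8] -/
def rankSeq (μ : Finset σ → ℝ) (k : ℕ) : ℝ := ∑ S ∈ powersetCard k univ, μ S

omit [DecidableEq σ] in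
/-- Unfolding `rankSeq`. [cite: BorceaBrandenLiggett2007, §2.1 Def. 2.8] -/
theorem rankSeq_def (μ : Finset σ → ℝ) (k : ℕ) : rankSeq μ k = ∑ S ∈ powersetCard k univ, μ S := rfl

omit [DecidableEq σ] in
/-- For `μ(S) = b(|S|)`: `r_k = binom(n,k) b(k)`. [cite: BorceaBrandenLiggett2007, §3.5 Thm. 3.8] -/
theorem rankSeq_card (b : ℕ → ℝ) (k : ℕ) :
    rankSeq (fun S : Finset σ => b S.card) k = ((Fintype.card σ).choose k : ℝ) * b k := by
  rw [rankSeq, Finset.sum_congr rfl fun S hS => by rw [(Finset.mem_powersetCard.1 hS).2], Finset.sum_const,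
    Finset.card_powersetCard, Finset.card_univ, nsmul_eq_mul]

/-- **The rank polynomial** `Σ_k r_k t^k = g_μ(t,…,t)` (the diagonal `Π↓` of the generating polynomial; tree
`diagonal` = BBL's diagonal specialization `Δ(g_μ)` of Def. 2.8). [cite: BorceaBrandenLiggett2007, §2.1 Def. 2.8
(`Δ(f)(t) = f(t,…,t)`) and §3.5 Thm. 3.8 ("the univariate polynomial `Σ_k r_k z^k`")] -/
def rankPoly (μ : Finset σ → ℝ) : Polynomial ℝ := diagonal (multiAffine μ)

omit [DecidableEq σ] in
/-- `[t^k] Σ_j r_j t^j = r_k`. [cite: BorceaBrandenLiggett2007, §3.5 Thm. 3.8] -/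
theorem coeff_rankPoly (μ : Finset σ → ℝ) (k : ℕ) : (rankPoly μ).coeff k = rankSeq μ k :=
  coeff_diagonal_multiAffine μ k

omit [DecidableEq σ] in
/-- `deg (Σ_k r_k t^k) ≤ n`. [cite: BorceaBrandenLiggett2007, §3.5 Thm. 3.8] -/
theorem natDegree_rankPoly_le (μ : Finset σ → ℝ) : (rankPoly μ).natDegree ≤ Fintype.card σ :=
  natDegree_diagonal_multiAffine_le μ

omit [DecidableEq σ] in
/-- `Σ_k r_k t^k` written out. [cite: BorceaBrandenLiggett2007, §3.5 Thm. 3.8] -/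
theorem rankPoly_eq_sum (μ : Finset σ → ℝ) :
    rankPoly μ = ∑ k ∈ range (Fintype.card σ + 1), Polynomial.C (rankSeq μ k) * Polynomial.X ^ k := by
  rw [(rankPoly μ).as_sum_range' (Fintype.card σ + 1) (Nat.lt_succ_of_le (natDegree_rankPoly_le μ))]
  refine Finset.sum_congr rfl fun k _ => ?_
  rw [coeff_rankPoly, ← Polynomial.C_mul_X_pow_eq_monomial]

omit [DecidableEq σ] in
/-- The rank polynomial over `ℂ` is the diagonal of the complex generating polynomial.
[cite: BorceaBrandenLiggett2007, §3.5 Thm. 3.8] -/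
theorem map_rankPoly (μ : Finset σ → ℝ) :
    (rankPoly μ).map (algebraMap ℝ ℂ) = diagonal (multiAffine fun S : Finset σ => (μ S : ℂ)) := by
  rw [rankPoly, diagonal_multiAffine, diagonal_multiAffine, Polynomial.map_sum]
  refine Finset.sum_congr rfl fun S _ => ?_
  rw [Polynomial.map_mul, Polynomial.map_C, Polynomial.map_pow, Polynomial.map_X]
  rfl

omit [DecidableEq σ] in
/-- A non-zero exchangeable weight has a non-zero rank polynomial (`r_k = binom(n,k) b(k)`).
[cite: BorceaBrandenLiggett2007, §3.5 Thm. 3.8] -/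
theorem rankPoly_card_ne_zero {b : ℕ → ℝ} (h : ¬ ∀ S : Finset σ, b S.card = 0) :
    rankPoly (fun S : Finset σ => b S.card) ≠ 0 := by
  push Not at h
  obtain ⟨S, hS⟩ := h
  intro h0
  have hc := congrArg (fun P : Polynomial ℝ => P.coeff S.card) h0
  simp only [coeff_rankPoly, rankSeq_card, Polynomial.coeff_zero] at hc
  rcases mul_eq_zero.1 hc with h1 | h1
  · exact (Nat.choose_pos (Finset.card_le_univ S)).ne' (by exact_mod_cast h1)
  · exact hS h1

end Rank

/-! ## §3 Real univariate polynomials: no zeros in `ℋ` iff only real zeros -/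

section Univariate

/-- For a non-zero real polynomial: no zero in the open upper half-plane iff all complex zeros are real
(complex conjugation). [cite: BorceaBrandenLiggett2007, §3.1 ("A univariate polynomial with real
coefficients is stable if and only if it has all real zeros")] -/
theorem forall_roots_im_eq_zero_iff {P : Polynomial ℝ} (hP : P ≠ 0) :
    (∀ ζ ∈ (P.map (algebraMap ℝ ℂ)).roots, ζ.im = 0) ↔
      ∀ t : ℂ, 0 < t.im → (P.map (algebraMap ℝ ℂ)).eval t ≠ 0 := by
  have hP' : P.map (algebraMap ℝ ℂ) ≠ 0 := Polynomial.map_ne_zero hP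
  constructor
  · intro h t ht h0
    have := h t ((Polynomial.mem_roots hP').2 h0)
    exact ht.ne' this
  · intro h ζ hζ
    have h0 : (P.map (algebraMap ℝ ℂ)).eval ζ = 0 := (Polynomial.mem_roots hP').1 hζ
    rcases lt_trichotomy ζ.im 0 with hlt | heq | hgt
    · exfalso
      refine h (conj ζ) (by rw [Complex.conj_im]; linarith) ?_
      rw [← conj_eval_map_algebraMap, h0, map_zero]
    · exact heq
    · exact absurd h0 (h ζ hgt)

end Univariate

/-! ## §4 Theorem 3.8: exchangeable strongly Rayleigh measures -/

section Thm38

omit [DecidableEq σ] in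
/-- **Borcea–Brändén–Liggett, Theorem 3.8 (Exchangeable Strongly Rayleigh Case), (a) ⟺ (b).** "Suppose
`μ ∈ 𝔓_n` has a symmetric generating polynomial and rank sequence `{r_k}_{k=0}^n`. The following are
equivalent: (a) The generating polynomial of `μ` is stable, i.e., `μ` is strongly Rayleigh; (b) All zeros of
the univariate polynomial `Σ_{k=0}^n r_k z^k` are real" — here for any real weight `μ(S) = b(|S|)` (the zero
weight included on both sides), "(a)" in the form `StableOrZero`. Proof as printed: "a consequence of the
Grace–Walsh–Szegő coincidence theorem" — `g_μ` is the polarization of `g_μ(t,…,t) = Σ_k r_k t^k` (tree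
`polarization_diagonal`, `isUpperHalfPlaneStable_polarization_iff`), and a real univariate polynomial is stable
iff real-rooted. [cite: BorceaBrandenLiggett2007, §3.5 Thm. 3.8 (a) ⟺ (b)] -/
theorem stableOrZero_card_iff (b : ℕ → ℝ) :
    StableOrZero (fun S : Finset σ => b S.card) ↔
      ∀ ζ ∈ ((rankPoly fun S : Finset σ => b S.card).map (algebraMap ℝ ℂ)).roots, ζ.im = 0 := by
  classical
  by_cases hzero : ∀ S : Finset σ, b S.card = 0
  · -- the zero weight: both sides hold
    have hP : rankPoly (fun S : Finset σ => b S.card) = 0 := by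
      rw [rankPoly_eq_sum]
      refine Finset.sum_eq_zero fun k _ => ?_
      rw [rankSeq, Finset.sum_eq_zero fun S _ => hzero S, map_zero, zero_mul]
    simp only [hP, Polynomial.map_zero, Polynomial.roots_zero, Multiset.notMem_zero, false_imp_iff, imp_true_iff,
      iff_true]
    exact Or.inl hzero
  · -- a non-zero weight: (a) ⟺ `g_μ` stable ⟺ `Σ r_k t^k` zero-free on `ℋ` ⟺ real-rooted
    set F : MvPolynomial σ ℂ := multiAffine fun S : Finset σ => ((b S.card : ℝ) : ℂ) with hF
    have hFs : ∀ e : Equiv.Perm σ, rename (⇑e) F = F := fun e =>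
      rename_equiv_multiAffine_card (fun k => ((b k : ℝ) : ℂ)) e
    have hFma : IsMultiAffine F := isMultiAffine_multiAffine _
    have hdiag : diagonal F = (rankPoly fun S : Finset σ => b S.card).map (algebraMap ℝ ℂ) := by
      rw [map_rankPoly]
    have hst : StableOrZero (fun S : Finset σ => b S.card) ↔ IsUpperHalfPlaneStable F := by
      rw [StableOrZero, or_iff_right hzero, hF, isUpperHalfPlaneStable_multiAffine_iff]
    rw [hst, ← polarization_diagonal hFma hFs, isUpperHalfPlaneStable_polarization_iff (natDegree_diagonal_le hFma),
      hdiag, forall_roots_im_eq_zero_iff (rankPoly_card_ne_zero hzero)]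

/-- **Theorem 3.8 (a) ⟺ (b) for exchangeable weights** (`IsExchangeable`, Def. 2.1).
[cite: BorceaBrandenLiggett2007, §3.5 Thm. 3.8 (a) ⟺ (b)] -/
theorem IsExchangeable.stableOrZero_iff {μ : Finset σ → ℝ} (h : IsExchangeable μ) :
    StableOrZero μ ↔ ∀ ζ ∈ ((rankPoly μ).map (algebraMap ℝ ℂ)).roots, ζ.im = 0 := by
  obtain ⟨b, rfl⟩ := h.exists_eq_card
  exact stableOrZero_card_iff b

/-- Theorem 3.8 in the `StableOrZero ↔ IsRealStable` vocabulary: a non-zero exchangeable weight has real stable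
generating polynomial iff its rank polynomial is real-rooted. [cite: BorceaBrandenLiggett2007, §3.5 Thm. 3.8
(a) ⟺ (b)] -/
theorem IsExchangeable.isRealStable_iff_roots_real {μ : Finset σ → ℝ} (h : IsExchangeable μ) (hne : μ ≠ 0) :
    IsRealStable (multiAffine μ) ↔ ∀ ζ ∈ ((rankPoly μ).map (algebraMap ℝ ℂ)).roots, ζ.im = 0 := by
  rw [← h.stableOrZero_iff, StableOrZero, isRealStable_multiAffine_iff, or_iff_right]
  intro h0
  exact hne (funext h0)

end Thm38

end Literature.Probability.NegativeDependence

end
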